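import Mathlib
import HarnessLib
import Summits.AtomisticToContinuum.FouriersLaw.Theses.LocalOhmBV

/-!
# Bridge for stub S1 of line `birth` (crux `HiddenChargeMazur.DressedCharge`, item
stmt-AtomisticToContinuum-13509; `--supports` helper, closes nothing)

`LocalOhmBV.NoLocalIntegrals` (item stmt-AtomisticToContinuum-12074: every smooth local
conservation law of the infinite pinned anharmonic chain is `c·e₀ + (h − h∘τ) + k`) implies the
registered stub `stub_oddChargeCoboundary`: a momentum-ODD POLYNOMIAL range-`R` density `g` with
a polynomial local conservation law is the shift-coboundary of a POLYNOMIAL `2R`-site profile,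
`g(y₀,…,y_{2R}) = k(y₁,…,y_{2R}) − k(y₀,…,y_{2R−1})`.

Proof: apply the census to `f = g ∘ boxRestrict R`; momentum reversal kills `c·e₀ + k` and makes
`f = h₁ − h₁∘τ` with `h₁ = ½(h − h∘Θ)` smooth local; a support induction along
`h₁∘τ = h₁ − f` shows `h₁` ignores every site `≥ R` and `≤ −R−1`; so `g` is the coboundary of
`k(w) = −h₁(w placed at sites −R…R−1)`; finally `k(w) = k(0) − Σ_{j<2R} g(w_j,…,w_{2R−1},0,…,0)`
exhibits `k` as a polynomial.
-/

noncomputable section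

open Literature.MathematicalPhysics.KineticTheory.HeatConduction

namespace Summit.AtomisticToContinuum.FouriersLaw.Theorems.DressedCharge

/-! ## Polynomial block functions -/

/-- A polynomial block function (in the route's `MvPolynomial` encoding) is smooth. -/
theorem contDiff_of_exists_mvPolynomial {n : ℕ} {f : (Fin n → ℝ × ℝ) → ℝ}
    (hf : ∃ p : MvPolynomial (Fin n ⊕ Fin n) ℝ, ∀ y : Fin n → ℝ × ℝ,
      f y = MvPolynomial.eval (Sum.elim (fun i => (y i).1) (fun i => (y i).2)) p)
    {m : WithTop ℕ∞} : ContDiff ℝ m f := by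
  obtain ⟨p, hp⟩ := hf
  have hf' : f = fun y => MvPolynomial.eval (Sum.elim (fun i => (y i).1) (fun i => (y i).2)) p :=
    funext hp
  subst hf'
  clear hp
  induction p using MvPolynomial.induction_on with
  | C a => simpa using contDiff_const
  | add p q ihp ihq => simpa [map_add] using ihp.add ihq
  | mul_X p v ihp =>
    simp only [map_mul, MvPolynomial.eval_X]
    refine ihp.mul ?_
    cases v with
    | inl i => exact contDiff_fst.comp (contDiff_apply ℝ (ℝ × ℝ) i)
    | inr i => exact contDiff_snd.comp (contDiff_apply ℝ (ℝ × ℝ) i)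

/-- Substituting block coordinates or zeros into a polynomial block function gives a polynomial
block function: for `e : Fin m → Option (Fin n)`, `w ↦ g(i ↦ w (e i) or (0,0))` is polynomial. -/
theorem exists_mvPolynomial_substitute {m n : ℕ} {g : (Fin m → ℝ × ℝ) → ℝ}
    (hg : ∃ p : MvPolynomial (Fin m ⊕ Fin m) ℝ, ∀ y : Fin m → ℝ × ℝ,
      g y = MvPolynomial.eval (Sum.elim (fun i => (y i).1) (fun i => (y i).2)) p)
    (e : Fin m → Option (Fin n)) :
    ∃ p : MvPolynomial (Fin n ⊕ Fin n) ℝ, ∀ w : Fin n → ℝ × ℝ,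
      g (fun i => (e i).elim (0, 0) fun j => w j) =
        MvPolynomial.eval (Sum.elim (fun i => (w i).1) (fun i => (w i).2)) p := by
  obtain ⟨p, hp⟩ := hg
  classical
  let φ : Fin m ⊕ Fin m → MvPolynomial (Fin n ⊕ Fin n) ℝ :=
    Sum.elim (fun i => (e i).elim 0 fun j => MvPolynomial.X (Sum.inl j))
      (fun i => (e i).elim 0 fun j => MvPolynomial.X (Sum.inr j))
  refine ⟨MvPolynomial.bind₁ φ p, fun w => ?_⟩
  rw [hp, show MvPolynomial.eval (Sum.elim (fun i => (w i).1) (fun i => (w i).2)) (MvPolynomial.bind₁ φ p)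
      = MvPolynomial.eval (fun v => MvPolynomial.eval (Sum.elim (fun i => (w i).1) (fun i => (w i).2)) (φ v)) p
      from MvPolynomial.eval₂Hom_bind₁ _ _ _ _]
  have hcoord : (Sum.elim (fun i => ((e i).elim (0, 0) fun j => w j).1) (fun i => ((e i).elim (0, 0) fun j => w j).2)
      : Fin m ⊕ Fin m → ℝ) =
      fun v => MvPolynomial.eval (Sum.elim (fun i => (w i).1) (fun i => (w i).2)) (φ v) := by
    funext v
    cases v with
    | inl i =>
      simp only [Sum.elim_inl, φ]
      cases e i with
      | none => simp
      | some j => simp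
    | inr i =>
      simp only [Sum.elim_inr, φ]
      cases e i with
      | none => simp
      | some j => simp
  rw [hcoord]

/-- Constants minus finite sums of polynomial block functions are polynomial block functions. -/
theorem exists_mvPolynomial_const_sub_sum {n : ℕ} (a : ℝ) (s : Finset ℕ)
    (F : ℕ → (Fin n → ℝ × ℝ) → ℝ)
    (hF : ∀ j ∈ s, ∃ p : MvPolynomial (Fin n ⊕ Fin n) ℝ, ∀ w : Fin n → ℝ × ℝ,
      F j w = MvPolynomial.eval (Sum.elim (fun i => (w i).1) (fun i => (w i).2)) p) :
    ∃ p : MvPolynomial (Fin n ⊕ Fin n) ℝ, ∀ w : Fin n → ℝ × ℝ,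
      a - ∑ j ∈ s, F j w = MvPolynomial.eval (Sum.elim (fun i => (w i).1) (fun i => (w i).2)) p := by
  classical
  induction s using Finset.induction_on with
  | empty => exact ⟨MvPolynomial.C a, fun w => by simp⟩
  | insert j s hj ih =>
    obtain ⟨q, hq⟩ := ih fun i hi => hF i (Finset.mem_insert_of_mem hi)
    obtain ⟨r, hr⟩ := hF j (Finset.mem_insert_self j s)
    refine ⟨q - r, fun w => ?_⟩
    rw [Finset.sum_insert hj, map_sub, ← hq, hr]
    ring

/-! ## The bridge -/

/-- **S1 from the census** (`LocalOhmBV.NoLocalIntegrals ⟹ stub_oddChargeCoboundary`): for the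
pinned anharmonic chain (all parameters `> 0`), if every smooth local conservation law is
`c·e₀ + (h − h∘τ) + k` (item stmt-AtomisticToContinuum-12074), then every momentum-odd polynomial
range-`R` density with a polynomial local conservation law is the shift-coboundary
`g(y) = k(y ∘ Fin.succ) − k(y ∘ Fin.castSucc)` of a polynomial `2R`-site profile `k`. -/
theorem stub_oddChargeCoboundary_of_noLocalIntegrals :
    Summit.AtomisticToContinuum.FouriersLaw.Theses.LocalOhmBV.NoLocalIntegrals →
    ∀ ω₂ lam β γ : ℝ, 0 < ω₂ → 0 < lam → 0 < β → 0 < γ →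
    ∀ P : OscillatorChain, P = pinnedChain ω₂ lam β γ →
    ∀ (R : ℕ) (g : (Fin (2 * R + 1) → ℝ × ℝ) → ℝ) (ψ : (Fin (2 * (R + 1) + 1) → ℝ × ℝ) → ℝ),
      (∃ p : MvPolynomial (Fin (2 * R + 1) ⊕ Fin (2 * R + 1)) ℝ, ∀ y : Fin (2 * R + 1) → ℝ × ℝ, g y = MvPolynomial.eval (Sum.elim (fun i => (y i).1) (fun i => (y i).2)) p) →
      (∃ p : MvPolynomial (Fin (2 * (R + 1) + 1) ⊕ Fin (2 * (R + 1) + 1)) ℝ, ∀ y : Fin (2 * (R + 1) + 1) → ℝ × ℝ, ψ y = MvPolynomial.eval (Sum.elim (fun i => (y i).1) (fun i => (y i).2)) p) →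
      (∀ y : Fin (2 * R + 1) → ℝ × ℝ, g (fun i => ((y i).1, -(y i).2)) = -g y) →
      (∀ σ : ℤ → ℝ × ℝ, (∑' x : ℤ, ((σ x).2 * deriv (fun t => g (fun i : Fin (2 * R + 1) => Function.update σ x (t, (σ x).2) ((i : ℤ) - (R : ℕ)))) (σ x).1 + (-deriv P.U (σ x).1 + (deriv P.V ((σ (x + 1)).1 - (σ x).1) - deriv P.V ((σ x).1 - (σ (x - 1)).1))) * deriv (fun t => g (fun i : Fin (2 * R + 1) => Function.update σ x ((σ x).1, t) ((i : ℤ) - (R : ℕ)))) (σ x).2)) = ψ (fun i : Fin (2 * (R + 1) + 1) => σ ((i : ℤ) - (R + 1 : ℕ))) - ψ (fun i : Fin (2 * (R + 1) + 1) => σ ((i : ℤ) - (R + 1 : ℕ) + 1))) →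
      ∃ k : (Fin (2 * R) → ℝ × ℝ) → ℝ,
        (∃ p : MvPolynomial (Fin (2 * R) ⊕ Fin (2 * R)) ℝ, ∀ w : Fin (2 * R) → ℝ × ℝ, k w = MvPolynomial.eval (Sum.elim (fun i => (w i).1) (fun i => (w i).2)) p) ∧
        ∀ y : Fin (2 * R + 1) → ℝ × ℝ, g y = k (fun i => y i.succ) - k (fun i => y (Fin.castSucc i)) := by
  intro hNLI ω₂ lam β γ hω hl hβ _hγ P hP R g ψ hg hψ hodd hlaw
  subst hP
  -- the local density and its flux in the tree's vocabulary
  set f : ChainConfig → ℝ := g ∘ boxRestrict R with hf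
  have hfs : ∃ (R' : ℕ) (g' : (Fin (2 * R' + 1) → ℝ × ℝ) → ℝ),
      ContDiff ℝ ((⊤ : ℕ∞) : WithTop ℕ∞) g' ∧ f = g' ∘ boxRestrict R' :=
    ⟨R, g, contDiff_of_exists_mvPolynomial hg, rfl⟩
  have hψs : ∃ ψ' : ChainConfig → ℝ, (∃ (R' : ℕ) (g' : (Fin (2 * R' + 1) → ℝ × ℝ) → ℝ),
      ContDiff ℝ ((⊤ : ℕ∞) : WithTop ℕ∞) g' ∧ ψ' = g' ∘ boxRestrict R') ∧
      ∀ σ, liouvilleZ (pinnedChain ω₂ lam β γ) f σ = ψ' σ - ψ' (shift σ) :=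
    ⟨ψ ∘ boxRestrict (R + 1), ⟨R + 1, ψ, contDiff_of_exists_mvPolynomial hψ, rfl⟩, fun σ => hlaw σ⟩
  -- the census
  obtain ⟨c, k0, h, ⟨R₁, G₁, _hG₁, hh⟩, hform⟩ := hNLI ω₂ lam β γ hω hl hβ f hfs hψs
  -- momentum reversal: `f` is odd, the site energy even, so `f = h₁ - h₁ ∘ shift`, `h₁ = ½(h - h∘Θ)`
  have hfodd : ∀ σ, f (momentumReversalZ σ) = -f σ := fun σ => hodd (boxRestrict R σ)
  set h₁ : ChainConfig → ℝ := fun σ => (h σ - h (momentumReversalZ σ)) / 2 with hh₁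
  have key : ∀ σ, f σ = h₁ σ - h₁ (shift σ) := by
    intro σ
    have e1 := hform σ
    have e2 := hform (momentumReversalZ σ)
    rw [hfodd, shift_momentumReversalZ] at e2
    simp only [momentumReversalZ_apply, even_two, Even.neg_pow] at e2
    simp only [hh₁]
    linarith
  have key' : ∀ σ, h₁ (shift σ) = h₁ σ - f σ := fun σ => by linarith [key σ]
  -- locality
  have hbox_update : ∀ (R' : ℕ) (σ : ChainConfig) (t : ℤ) (v : ℝ × ℝ), (t < -(R' : ℤ) ∨ (R' : ℤ) < t) →
      boxRestrict R' (Function.update σ t v) = boxRestrict R' σ := by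
    intro R' σ t v ht
    funext i
    have hi : (i : ℕ) < 2 * R' + 1 := i.isLt
    simp only [boxRestrict_apply]
    rw [Function.update_of_ne]
    omega
  have hmR_update : ∀ (σ : ChainConfig) (t : ℤ) (v : ℝ × ℝ),
      momentumReversalZ (Function.update σ t v) = Function.update (momentumReversalZ σ) t (v.1, -v.2) := by
    intro σ t v
    funext x
    by_cases hx : x = t
    · subst hx; simp
    · simp [Function.update_of_ne hx]
  have hloc_h₁ : ∀ t : ℤ, (t < -(R₁ : ℤ) ∨ (R₁ : ℤ) < t) → ∀ (σ : ChainConfig) (v : ℝ × ℝ),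
      h₁ (Function.update σ t v) = h₁ σ := by
    intro t ht σ v
    simp only [hh₁, hh, Function.comp_apply, hmR_update, hbox_update R₁ _ t _ ht]
  have hloc_f : ∀ t : ℤ, (t < -(R : ℤ) ∨ (R : ℤ) < t) → ∀ (σ : ChainConfig) (v : ℝ × ℝ),
      f (Function.update σ t v) = f σ := by
    intro t ht σ v
    simp only [hf, Function.comp_apply, hbox_update R _ t _ ht]
  have hshift_update : ∀ (σ : ChainConfig) (t : ℤ) (v : ℝ × ℝ),
      shift (Function.update σ t v) = Function.update (shift σ) (t - 1) v := by
    intro σ t v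
    funext x
    show Function.update σ t v (x + 1) = Function.update (shift σ) (t - 1) v x
    by_cases hx : x = t - 1
    · subst hx; simp
    · rw [Function.update_of_ne hx, Function.update_of_ne (by omega)]
      rfl
  -- support induction to the right: `h₁` ignores every site `≥ R`
  have step_right : ∀ t : ℤ, (R : ℤ) + 1 ≤ t → (∀ (σ : ChainConfig) (v : ℝ × ℝ), h₁ (Function.update σ t v) = h₁ σ) →
      ∀ (σ : ChainConfig) (v : ℝ × ℝ), h₁ (Function.update σ (t - 1) v) = h₁ σ := by
    intro t ht hD σ v
    set ρ : ChainConfig := fun x => σ (x - 1) with hρ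
    have hσ : shift ρ = σ := by funext x; simp [shift, hρ]
    rw [← hσ, ← hshift_update, key', key', hD ρ v, hloc_f t (Or.inr (by omega)) ρ v]
  -- support induction to the left: `h₁` ignores every site `≤ -R-1`
  have step_left : ∀ t : ℤ, t ≤ -(R : ℤ) - 1 → (∀ (σ : ChainConfig) (v : ℝ × ℝ), h₁ (Function.update σ (t - 1) v) = h₁ σ) →
      ∀ (σ : ChainConfig) (v : ℝ × ℝ), h₁ (Function.update σ t v) = h₁ σ := by
    intro t ht hD σ v
    have e1 : h₁ (Function.update σ t v) = h₁ (shift (Function.update σ t v)) + f (Function.update σ t v) := by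
      linarith [key (Function.update σ t v)]
    rw [e1, hshift_update, hD (shift σ) v, hloc_f t (Or.inl (by omega)) σ v]
    linarith [key σ]
  set M : ℕ := max R₁ R with hM
  have hMR : R ≤ M := le_max_right _ _
  have hMR₁ : R₁ ≤ M := le_max_left _ _
  have hDR : ∀ n : ℕ, (R : ℤ) ≤ (M : ℤ) + 1 - n →
      ∀ (σ : ChainConfig) (v : ℝ × ℝ), h₁ (Function.update σ ((M : ℤ) + 1 - n) v) = h₁ σ := by
    intro n
    induction n with
    | zero =>
      intro _ σ v
      simp only [Nat.cast_zero, sub_zero]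
      exact hloc_h₁ _ (Or.inr (by omega)) σ v
    | succ n ih =>
      intro hn σ v
      have e : (M : ℤ) + 1 - ((n + 1 : ℕ) : ℤ) = (M : ℤ) + 1 - n - 1 := by push_cast; ring
      rw [e]
      exact step_right _ (by push_cast at hn; omega) (ih (by push_cast at hn; omega)) σ v
  have hD_R : ∀ (σ : ChainConfig) (v : ℝ × ℝ), h₁ (Function.update σ (R : ℤ) v) = h₁ σ := by
    have e : (M : ℤ) + 1 - ((M + 1 - R : ℕ) : ℤ) = R := by
      rw [Nat.cast_sub (by omega)]; push_cast; ring
    have := hDR (M + 1 - R) (by rw [e])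
    rw [e] at this
    exact this
  have hDL : ∀ n : ℕ, -(M : ℤ) - 1 + n ≤ -(R : ℤ) - 1 →
      ∀ (σ : ChainConfig) (v : ℝ × ℝ), h₁ (Function.update σ (-(M : ℤ) - 1 + n) v) = h₁ σ := by
    intro n
    induction n with
    | zero =>
      intro _ σ v
      simp only [Nat.cast_zero, add_zero]
      exact hloc_h₁ _ (Or.inl (by omega)) σ v
    | succ n ih =>
      intro hn σ v
      refine step_left _ hn (fun σ' v' => ?_) σ v
      have e : -(M : ℤ) - 1 + ((n + 1 : ℕ) : ℤ) - 1 = -(M : ℤ) - 1 + n := by push_cast; ring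
      rw [e]
      exact ih (by push_cast at hn; omega) σ' v'
  have hD_L : ∀ (σ : ChainConfig) (v : ℝ × ℝ), h₁ (Function.update σ (-(R : ℤ) - 1) v) = h₁ σ := by
    have e : -(M : ℤ) - 1 + ((M - R : ℕ) : ℤ) = -(R : ℤ) - 1 := by
      rw [Nat.cast_sub hMR]; ring
    have := hDL (M - R) (by rw [e])
    rw [e] at this
    exact this
  -- the embedding of a window into a configuration (zero outside `[-R, R]`)
  set emb : (Fin (2 * R + 1) → ℝ × ℝ) → ChainConfig := fun y x =>
    if hx : 0 ≤ x + R ∧ x + R < 2 * R + 1 then y ⟨(x + R).toNat, by omega⟩ else (0, 0) with hemb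
  have hbox_emb : ∀ y, boxRestrict R (emb y) = y := by
    intro y
    funext i
    have hi : (i : ℕ) < 2 * R + 1 := i.isLt
    simp only [boxRestrict_apply, hemb]
    rw [dif_pos (by constructor <;> omega)]
    congr 1
    apply Fin.ext
    simp only
    omega
  have hg_emb : ∀ y, g y = f (emb y) := by
    intro y
    simp only [hf, Function.comp_apply, hbox_emb]
  -- extension of a `2R`-block by a trailing zero site
  set ext : (Fin (2 * R) → ℝ × ℝ) → (Fin (2 * R + 1) → ℝ × ℝ) := fun w i =>
    if h : i.val < 2 * R then w ⟨i.val, h⟩ else (0, 0) with hext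
  have hcut_right : ∀ y : Fin (2 * R + 1) → ℝ × ℝ,
      emb (ext fun i => y (Fin.castSucc i)) = Function.update (emb y) (R : ℤ) (0, 0) := by
    intro y
    funext x
    rw [Function.update_apply]
    by_cases hx : x = R
    · subst hx
      rw [if_pos rfl]
      simp only [hemb, hext]
      rw [dif_pos (by constructor <;> omega), dif_neg (by omega)]
    · rw [if_neg hx]
      simp only [hemb, hext]
      by_cases hx' : 0 ≤ x + R ∧ x + R < 2 * R + 1
      · rw [dif_pos hx', dif_pos hx', dif_pos (by omega)]
        rfl
      · rw [dif_neg hx', dif_neg hx']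
  have hcut_left : ∀ y : Fin (2 * R + 1) → ℝ × ℝ,
      shift (emb y) = Function.update (emb (ext fun i => y i.succ)) (-(R : ℤ) - 1) (y 0) := by
    intro y
    funext x
    rw [Function.update_apply]
    show emb y (x + 1) = _
    by_cases hx : x = -(R : ℤ) - 1
    · subst hx
      rw [if_pos rfl]
      simp only [hemb]
      rw [dif_pos (by constructor <;> omega)]
      congr 1
      apply Fin.ext
      simp
    · rw [if_neg hx]
      simp only [hemb, hext]
      by_cases hx' : 0 ≤ x + R ∧ x + R < 2 * R + 1
      · rw [dif_pos hx']
        by_cases hx'' : x + R < 2 * R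
        · rw [dif_pos (by omega), dif_pos (by omega)]
          congr 1
          apply Fin.ext
          simp only [Fin.val_succ]
          omega
        · rw [dif_neg (by omega), dif_neg (by omega)]
      · rw [dif_neg hx', dif_neg (by omega)]
  -- the profile
  set k : (Fin (2 * R) → ℝ × ℝ) → ℝ := fun w => -h₁ (emb (ext w)) with hk
  have hcob : ∀ y : Fin (2 * R + 1) → ℝ × ℝ, g y = k (fun i => y i.succ) - k (fun i => y (Fin.castSucc i)) := by
    intro y
    rw [hg_emb, key (emb y), hcut_left, hD_L, ← hD_R (emb y) (0, 0), ← hcut_right]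
    simp only [hk]
    ring
  refine ⟨k, ?_, hcob⟩
  -- polynomiality: `k w = k 0 - Σ_{j<2R} g(ext (S^j w))`, `S` the shift-in of a zero
  set S : (Fin (2 * R) → ℝ × ℝ) → (Fin (2 * R) → ℝ × ℝ) := fun w i =>
    if h : i.val + 1 < 2 * R then w ⟨i.val + 1, h⟩ else (0, 0) with hS
  have hstep : ∀ w, k w = k (S w) - g (ext w) := by
    intro w
    have e := hcob (ext w)
    have e1 : (fun i : Fin (2 * R) => ext w (Fin.castSucc i)) = w := by
      funext i
      simp only [hext, Fin.val_castSucc, dif_pos i.isLt]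
    have e2 : (fun i : Fin (2 * R) => ext w i.succ) = S w := by
      funext i
      simp only [hext, hS, Fin.val_succ]
    rw [e1, e2] at e
    linarith
  have hiter : ∀ (j : ℕ) (w : Fin (2 * R) → ℝ × ℝ),
      S^[j] w = fun i => if h : i.val + j < 2 * R then w ⟨i.val + j, h⟩ else (0, 0) := by
    intro j
    induction j with
    | zero => intro w; funext i; simp
    | succ j ih =>
      intro w
      rw [Function.iterate_succ_apply', ih]
      funext i
      simp only [hS]
      by_cases h1 : i.val + 1 < 2 * R
      · rw [dif_pos h1]
        by_cases h2 : i.val + (j + 1) < 2 * R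
        · rw [dif_pos h2, dif_pos (by omega)]
          congr 1
          apply Fin.ext
          simp only
          omega
        · rw [dif_neg h2, dif_neg (by omega)]
      · rw [dif_neg h1, dif_neg (by omega)]
  have hsum : ∀ (n : ℕ) (w : Fin (2 * R) → ℝ × ℝ),
      k w = k (S^[n] w) - ∑ j ∈ Finset.range n, g (ext (S^[j] w)) := by
    intro n
    induction n with
    | zero => intro w; simp
    | succ n ih =>
      intro w
      rw [Finset.sum_range_succ, Function.iterate_succ_apply', ih w, hstep (S^[n] w)]
      ring
  have hzero : ∀ w : Fin (2 * R) → ℝ × ℝ, S^[2 * R] w = fun _ => (0, 0) := by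
    intro w
    rw [hiter]
    funext i
    rw [dif_neg (by omega)]
  -- each summand is a substitution instance of `g`
  have hterm : ∀ j ∈ Finset.range (2 * R), ∃ p : MvPolynomial (Fin (2 * R) ⊕ Fin (2 * R)) ℝ,
      ∀ w : Fin (2 * R) → ℝ × ℝ, g (ext (S^[j] w)) =
        MvPolynomial.eval (Sum.elim (fun i => (w i).1) (fun i => (w i).2)) p := by
    intro j _
    obtain ⟨p, hp⟩ := exists_mvPolynomial_substitute hg
      (fun i : Fin (2 * R + 1) => if h : i.val + j < 2 * R then some ⟨i.val + j, h⟩ else none)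
    refine ⟨p, fun w => ?_⟩
    rw [← hp w, hiter]
    congr 1
    funext i
    simp only [hext]
    by_cases h1 : i.val < 2 * R
    · rw [dif_pos h1]
      by_cases h2 : i.val + j < 2 * R
      · rw [dif_pos (by omega), dif_pos h2]
        rfl
      · rw [dif_neg (by omega), dif_neg h2]
        rfl
    · rw [dif_neg h1, dif_neg (by omega)]
      rfl
  obtain ⟨p, hp⟩ := exists_mvPolynomial_const_sub_sum (k fun _ => (0, 0)) (Finset.range (2 * R))
    (fun j w => g (ext (S^[j] w))) hterm
  refine ⟨p, fun w => ?_⟩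
  rw [← hp w, hsum (2 * R) w, hzero w]

end Summit.AtomisticToContinuum.FouriersLaw.Theorems.DressedCharge

end
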